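import Summits.Ventures.QEC.Census.CSSNormalFormK1
import HarnessLib

/-!
# Transport of the normal-form conditions `(Z)`, `(X)` along index bijections (KERNEL-PLAN item 3a')

`CSSNormalForm.exists_normalForm` produces `(A, s)` indexed by the subtypes `{q // q ∈ I}`, `{q // q ∉ I}`; the encoder side wants
`Fin b`, `Fin m` (and `s` sorted). This file: Hamming weight is invariant under reindexing (`hammingNorm_comp_equiv`) and conditions
`(Z)`/`(X)` transport to `A.submatrix eκ.symm eμ.symm`, `s ∘ eμ.symm` for any bijections `eκ`, `eμ` (`condZ_reindex`, `condX_reindex`).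
Choosing `eμ` so that `s ∘ eμ.symm = sVec` (sorting) is the sibling step. [folklore]
-/

set_option autoImplicit false

namespace Summit.Ventures.QEC.Census.CSSNormalFormSAT

open Matrix

/-- Hamming weight is invariant under a bijective reindexing. [folklore] -/
theorem hammingNorm_comp_equiv {ι κ : Type*} [Fintype ι] [Fintype κ] [DecidableEq ι] [DecidableEq κ]
    (e : ι ≃ κ) (x : κ → ZMod 2) : hammingNorm (x ∘ e) = hammingNorm x := by
  simp only [hammingNorm]
  have hset : (Finset.univ.filter fun i : ι => (x ∘ e) i ≠ 0) =
      (Finset.univ.filter fun k : κ => x k ≠ 0).map e.symm.toEmbedding := by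
    ext i
    simp [Finset.mem_map_equiv]
  rw [hset, Finset.card_map]

variable {κ μ : Type*} [Fintype κ] [Fintype μ] [DecidableEq κ] [DecidableEq μ] {b m : ℕ}

/-- `(Z)` transports along bijections `κ ≃ Fin b`, `μ ≃ Fin m`. [folklore] -/
theorem condZ_reindex (eκ : κ ≃ Fin b) (eμ : μ ≃ Fin m) (A : Matrix κ μ (ZMod 2)) (s : μ → ZMod 2) (d : ℕ)
    (hZ : ∀ v : κ → ZMod 2, d ≤ hammingNorm v + hammingNorm (v ᵥ* A + s)) :
    ∀ v' : Fin b → ZMod 2, d ≤ hammingNorm v' + hammingNorm (v' ᵥ* A.submatrix eκ.symm eμ.symm + s ∘ eμ.symm) := by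
  intro v'
  have h := hZ (v' ∘ eκ)
  have h1 : hammingNorm (v' ∘ eκ) = hammingNorm v' := hammingNorm_comp_equiv eκ v'
  have h2 : v' ᵥ* A.submatrix eκ.symm eμ.symm + s ∘ eμ.symm = ((v' ∘ eκ) ᵥ* A + s) ∘ eμ.symm := by
    rw [submatrix_vecMul_equiv]
    funext j
    simp
  rw [h2, hammingNorm_comp_equiv eμ.symm, ← h1]
  exact h

/-- `(X)` transports along bijections `κ ≃ Fin b`, `μ ≃ Fin m`. [folklore] -/
theorem condX_reindex (eκ : κ ≃ Fin b) (eμ : μ ≃ Fin m) (A : Matrix κ μ (ZMod 2)) (s : μ → ZMod 2) (d : ℕ)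
    (hX : ∀ u : μ → ZMod 2, u ⬝ᵥ s = 1 → d ≤ hammingNorm u + hammingNorm (A *ᵥ u)) :
    ∀ u' : Fin m → ZMod 2, u' ⬝ᵥ (s ∘ eμ.symm) = 1 →
      d ≤ hammingNorm u' + hammingNorm (A.submatrix eκ.symm eμ.symm *ᵥ u') := by
  intro u' hu'
  have hdot : (u' ∘ eμ) ⬝ᵥ s = 1 := by
    have : u' ⬝ᵥ (s ∘ eμ.symm) = (u' ∘ eμ) ⬝ᵥ s := by
      have e1 : (u' ∘ eμ) ∘ eμ.symm = u' := by funext j; simp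
      rw [← comp_equiv_dotProduct_comp_equiv (u' ∘ eμ) s eμ.symm, e1]
    rw [← this]; exact hu'
  have h := hX (u' ∘ eμ) hdot
  have h1 : hammingNorm (u' ∘ eμ) = hammingNorm u' := hammingNorm_comp_equiv eμ u'
  have h2 : A.submatrix eκ.symm eμ.symm *ᵥ u' = (A *ᵥ (u' ∘ eμ)) ∘ eκ.symm := by
    rw [submatrix_mulVec_equiv]
    simp
  rw [h2, hammingNorm_comp_equiv eκ.symm, ← h1]
  exact h

end Summit.Ventures.QEC.Census.CSSNormalFormSAT
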